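import Literature.Analysis.FluidPDE.KNSSMildRegularity
import Literature.Analysis.FluidPDE.KNSSRegularityGalileanProofs
import Literature.Analysis.FluidPDE.OseenDuhamelWeakStokes
import Literature.Analysis.FluidPDE.MildL3Restart
import Literature.Analysis.FluidPDE.VorticityEquation
import Literature.Analysis.FluidPDE.KNSSRegularityGluing
import HarnessLib

/-!
# KNSS 2009, §4 (4.8): bounded mild solutions are weak solutions, and the vorticity equation of
# a smooth bounded mild solution — proofs

Analysis/FluidPDE proofs file (everything proved; no named facts) discharging
`Literature.Analysis.FluidPDE.KNSS2009_vorticity48_mild` (`KNSSMildRegularity.lean`;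
Koch–Nadirashvili–Seregin–Šverák 2009, §4 p. 8: for `n = 3` the vorticity of a bounded solution
solves (4.8) `ω_{i,t} − Δω_i = ∂_j(ω_j u_i − ω_i u_j)`, "satisfied in the sense of distributions"
— classically for a smooth field — here for the tree's restarted-mild fields
`IsKNSSDriftMild T N V 0` that are jointly smooth, in time-integrated form), and closing the
tree's reduction of the ancient regularity fact
`Literature.Analysis.FluidPDE.KNSS2009_regularity_boundedWeak_ancient` (the §4 input of KNSS's
Theorems 5.2–5.3) to exactly two printed statements: **Lemma 3.1** in drift-mild form
(`KNSS2009_weak_driftMild`) and **Proposition 4.1 with (4.6)** (`KNSS2009_prop41_mild`)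
(`KNSS2009_regularity_boundedWeak_ancient_of_prop41'`).

* `integral_integral_inner_heatExtension_heatAdjoint_eq_zero` — the caloric extension of a
  bounded datum is a weak solution of the homogeneous system on `(0, T)`:
  `∫₀ᵀ∫⟪e^{tΔ}w, ∂ₜψ + Δψ⟫ = 0` (dual form `⟨e^{tΔ}w, Λ⟩ = ⟨w, e^{tΔ}Λ⟩`,
  `integral_inner_heatExtension_comm`, and the backward heat equation of the adjoint field,
  `integral_integral_inner_heatTest_heatAdjointField_eq_zero`).
* `IsKNSSDriftMild.isBoundedWeakNSSolutionOn_of_mem_Ioo` — **a restarted bounded mild solution is a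
  bounded weak Navier–Stokes solution on every window `(s₀, T)`** (KNSS §4 (i)–(ii)): after the
  time shift `u(τ) = V(τ + s₀)` (truncated outside `(0, T − s₀)`), the restarted identity reads
  `u + ∫₀^τ 𝒩_{τ−σ}(u⊗u) dσ = e^{τΔ}V(s₀)`; the Duhamel integral is a weak Stokes solution with
  forcing `−∇·(u⊗u)` (`integral_inner_driftDuhamel_zero_heatAdjoint_eq`, `OseenDuhamelWeakStokes`),
  the caloric part a homogeneous one, whence the weak identity for `u`; the a.e. divergence
  constraint and the class transfer along the time shift (`IsBoundedWeakNSSolutionOn.comp_add_right`,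
  `IsBoundedWeakNSSolutionOn.congr_slices`).
* `IsKNSSDriftMild.curl_sub_curl_eq_integral` — for a jointly smooth restarted-mild field:
  smoothness turns the weak identity into the projected momentum equation
  (`integral_inner_momentum_eq_zero_of_slab_weak`), which has a pressure
  (`exists_isClassicalNSSolutionOn_of_forall_integral_inner_eq_zero`) and hence the classical
  vorticity equation (`IsClassicalNSSolutionOn.vorticity_eq`); integrating in time (the vorticity
  is jointly smooth, `IsSmoothSpaceTimeOn.hasDerivWithinAt_timeDerivWithin`) and shifting back
  gives `ω(t,x) − ω(s,x) = ∫ₛᵗ (Δω − Dω[V] + DV[ω]) dτ`; `KNSS2009_vorticity48_mild_holds`.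
* `KNSS2009_mild_regularity_of_prop41'`, `KNSS2009_regularity_boundedWeak_window_of_prop41'`,
  `KNSS2009_regularity_boundedWeak_ancient_of_prop41'` — the compositions with the Galilean
  covariance `IsKNSSDriftMild.galileanCovariance_R3` and the constants glue.

## References

* G. Koch, N. Nadirashvili, G. Seregin, V. Šverák, *Liouville theorems for the Navier–Stokes
  equations and applications*, Acta Math. 203 (2009) 83–105 = arXiv:0709.3599v1, §4 p. 8
  ((i)–(ii), (4.4), Prop. 4.1, (4.8)); §5 p. 10. [KochNadirashviliSereginSverak2009]
* E. B. Fabes, B. F. Jones, N. M. Rivière, ARMA 45 (1972), Thm. 2.1 (duality form versus the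
  equations for regular fields). [FabesJonesRiviere1972]
-/

noncomputable section

open MeasureTheory Set Function Filter TopologicalSpace InnerProductSpace Metric
open _root_.Topology
open scoped RealInnerProductSpace Laplacian ContDiff NNReal ENNReal Interval

namespace Literature.Analysis.FluidPDE

/-! ### The caloric part is a weak solution of the homogeneous Stokes/heat system -/

section Caloric

variable {E : Type*} [NormedAddCommGroup E] [InnerProductSpace ℝ E] [FiniteDimensional ℝ E]
  [MeasurableSpace E] [BorelSpace E]

/-- **The caloric extension of a bounded datum is a weak solution of the homogeneous system**:
`∫₀ᵀ ∫ ⟪e^{tΔ}w, ∂ₜψ + Δψ⟫ dx dt = 0` for every space–time test field `ψ` on `(0, T) × E`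
(dual form: `⟨e^{tΔ}w, Λ(t)⟩ = ⟨w, e^{tΔ}Λ(t)⟩` and the tree's
`integral_integral_inner_heatTest_heatAdjointField_eq_zero`, the backward heat equation of the
adjoint field). [folklore] -/
theorem integral_integral_inner_heatExtension_heatAdjoint_eq_zero {w : E → E}
    (hw : AEStronglyMeasurable w volume) {M : ℝ} (hM : ∀ x, ‖w x‖ ≤ M) {T : ℝ} (hT : 0 < T)
    {ψ : ℝ → E → E} (hψ : IsSpaceTimeTestOn (slab E (Ioo 0 T) isOpen_Ioo) ψ) :
    ∫ t in Ioo 0 T, ∫ x, ⟪UnboundedOperators.heatExtension w t x, timeDeriv ψ t x + Δ (ψ t) x⟫ = 0 := by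
  haveI : CompleteSpace E := FiniteDimensional.complete ℝ E
  obtain ⟨a', b, ha'0, ha'b, hbT, hsupp⟩ := hψ.exists_time_support_Ioo hT
  have hψ' : IsSpaceTimeTestOn (⊤ : Opens (ℝ × E)) ψ := hψ.mono le_top
  have key := integral_integral_inner_heatTest_heatAdjointField_eq_zero (E := E) one_pos hw hM hψ'
    (a := 0) (b := T) hsupp ha'0 hT.le hbT.le
  have hΛ : IsSpaceTimeTestOn (⊤ : Opens (ℝ × E)) (fun t x => timeDeriv ψ t x + (1 : ℝ) • Δ (ψ t) x) :=
    hψ'.heatAdjointField_top 1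
  have hwp : MemLp w ∞ (volume : Measure E) := memLp_top_of_bound hw M (Eventually.of_forall hM)
  -- slice by slice: `⟨w, e^{tΔ}Λ(t)⟩ = ⟨e^{tΔ}w, Λ(t)⟩`
  have hslice : ∀ t ∈ Ioo (0 : ℝ) T,
      ∫ x, ⟪w x, heatTest 1 (fun y => timeDeriv ψ t y + (1 : ℝ) • Δ (ψ t) y) (t - 0) x⟫ =
        ∫ x, ⟪UnboundedOperators.heatExtension w t x, timeDeriv ψ t x + Δ (ψ t) x⟫ := by
    intro t ht
    rw [sub_zero, heatTest_of_pos one_pos ht.1, one_mul]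
    have hg : MemLp (fun y => timeDeriv ψ t y + (1 : ℝ) • Δ (ψ t) y) 1 (volume : Measure E) :=
      memLp_one_iff_integrable.2 ((hΛ.contDiff_slice t).continuous.integrable_of_hasCompactSupport
        (hΛ.hasCompactSupport_slice t))
    rw [integral_inner_heatExtension_comm (p := ∞) (q := 1) hwp hg ht.1]
    simp only [one_smul]
  rw [setIntegral_congr_set (Ioo_ae_eq_Ioc (α := ℝ) (a := 0) (b := T)).symm] at key
  exact ((setIntegral_congr_fun measurableSet_Ioo hslice).symm).trans key

end Caloric

/-! ### Transfer of the bounded weak class along equality of slices -/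

section Congr

variable {E : Type*} [NormedAddCommGroup E] [InnerProductSpace ℝ E] [FiniteDimensional ℝ E]
  [MeasurableSpace E] [BorelSpace E]

/-- The bounded weak class only sees the slices at times of `I`. [folklore] -/
theorem IsBoundedWeakNSSolutionOn.congr_slices {I : Set ℝ} {hI : IsOpen I} {ν : ℝ}
    {u v : ℝ → E → E} (h : IsBoundedWeakNSSolutionOn I hI ν u) (heq : ∀ t ∈ I, u t = v t) :
    IsBoundedWeakNSSolutionOn I hI ν v := by
  obtain ⟨hmeas, ⟨C, hC⟩, hdiv, hweak⟩ := h
  refine ⟨?_, ⟨C, fun t ht x => by rw [← heq t ht]; exact hC t ht x⟩, ?_, fun ψ hψ hψd => ?_⟩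
  · refine hmeas.congr ?_
    filter_upwards [ae_restrict_mem (hI.measurableSet.prod MeasurableSet.univ)] with q hq
    simp only [uncurry]
    rw [heq q.1 (mem_prod.1 hq).1]
  · filter_upwards [hdiv, ae_restrict_mem hI.measurableSet] with t ht htI
    rwa [← heq t htI]
  · rw [← hweak ψ hψ hψd]
    refine setIntegral_congr_fun hI.measurableSet fun t ht => ?_
    simp only [heq t ht]

end Congr

/-! ### A restarted bounded mild solution is a bounded weak solution on every window `(s₀, T)` -/

section MildWeak

variable {E : Type*} [NormedAddCommGroup E] [InnerProductSpace ℝ E] [FiniteDimensional ℝ E]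
  [MeasurableSpace E] [BorelSpace E]

namespace IsKNSSDriftMild

variable {T N : ℝ} {V : ℝ → E → E}

variable (hE : Module.finrank ℝ E = 3)
include hE

open Classical in
/-- **A restarted bounded mild solution is a bounded weak Navier–Stokes solution on every window
`(s₀, T)`** (`0 < s₀ < T`, `ν = 1`). With `u(τ) = V(τ + s₀)` on `(0, T − s₀)` (and `0` outside),
the restarted identity reads `u(τ) + ∫₀^τ 𝒩_{τ−σ}(u⊗u) dσ = e^{τΔ}V(s₀)`; the Duhamel integral is a
weak solution of the Stokes system with forcing `−∇·(u⊗u)`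
(`integral_inner_driftDuhamel_zero_heatAdjoint_eq`, `OseenDuhamelWeakStokes`) and the caloric
part of the homogeneous one, whence the weak Navier–Stokes identity for `u`; time translation
(`IsBoundedWeakNSSolutionOn.comp_add_right`) brings it back to `V` on `(s₀, T)` (KNSS 2009, §4
(i)–(ii): mild solutions are weak solutions). [cite: KochNadirashviliSereginSverak2009, §4 (i)–(ii) (arXiv:0709.3599v1 p. 8)] -/
theorem isBoundedWeakNSSolutionOn_of_mem_Ioo (h : IsKNSSDriftMild T N V 0) {s₀ : ℝ}
    (hs₀ : s₀ ∈ Ioo 0 T) : IsBoundedWeakNSSolutionOn (Ioo s₀ T) isOpen_Ioo 1 V := by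
  haveI : CompleteSpace E := FiniteDimensional.complete ℝ E
  set T' : ℝ := T - s₀ with hT'def
  have hT' : 0 < T' := sub_pos.2 hs₀.2
  have hN : 0 ≤ N := h.nonneg
  -- the shifted, truncated field
  set u : ℝ → E → E := (Ioo 0 T').piecewise (fun τ => V (τ + s₀)) 0 with hudef
  have hu_in : ∀ τ ∈ Ioo 0 T', u τ = V (τ + s₀) := fun τ hτ => Set.piecewise_eq_of_mem _ _ _ hτ
  have hu_out : ∀ τ ∉ Ioo 0 T', u τ = 0 := fun τ hτ => Set.piecewise_eq_of_notMem _ _ _ hτ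
  have hwin : ∀ τ ∈ Ioo 0 T', τ + s₀ ∈ Ioo 0 T := fun τ hτ =>
    ⟨by linarith [hτ.1, hs₀.1], by rw [hT'def] at hτ; linarith [hτ.2]⟩
  have hum : Measurable (uncurry u) := by
    have hf : Measurable fun q : ℝ × E => V (q.1 + s₀) q.2 :=
      h.measurable.comp ((measurable_fst.add_const s₀).prodMk measurable_snd)
    have he : uncurry u = (Ioo 0 T' ×ˢ (univ : Set E)).piecewise (fun q : ℝ × E => V (q.1 + s₀) q.2) 0 := by
      funext q
      by_cases hq : q.1 ∈ Ioo 0 T'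
      · rw [Set.piecewise_eq_of_mem _ _ _ (mk_mem_prod hq (mem_univ q.2))]
        simp only [uncurry, hu_in q.1 hq]
      · rw [Set.piecewise_eq_of_notMem _ _ _ (fun hm => hq (mem_prod.1 hm).1)]
        simp only [uncurry, hu_out q.1 hq, Pi.zero_apply]
    rw [he]
    exact hf.piecewise (measurableSet_Ioo.prod MeasurableSet.univ) measurable_const
  have huM : ∀ τ x, ‖u τ x‖ ≤ N := by
    intro τ x
    by_cases hτ : τ ∈ Ioo 0 T'
    · rw [hu_in τ hτ]; exact h.norm_le _ (hwin τ hτ) x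
    · rw [hu_out τ hτ]; simpa using hN
  -- the Duhamel integral after the time shift
  have hD : ∀ τ ∈ Ioo 0 T', ∀ x, driftDuhamel V 0 s₀ (τ + s₀) x =
      driftDuhamel u (fun _ => (0 : E)) 0 τ x := by
    intro τ hτ x
    rw [driftDuhamel_apply, driftDuhamel_apply]
    have hcv := intervalIntegral.integral_comp_add_right (a := 0) (b := τ)
      (fun σ => ∑ i, oseenHeat (τ + s₀ - σ) (driftTensor V 0 σ) i x • stdOrthonormalBasis ℝ E i) s₀
    rw [zero_add] at hcv
    rw [← hcv]
    refine intervalIntegral.integral_congr_ae ?_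
    refine Eventually.of_forall fun σ hσ => ?_
    rw [uIoc_of_le hτ.1.le] at hσ
    have hσ' : σ ∈ Ioo 0 T' := ⟨hσ.1, hσ.2.trans_lt hτ.2⟩
    have e1 : τ + s₀ - (σ + s₀) = τ - σ := by ring
    have e2 : driftTensor V 0 (σ + s₀) = driftTensor u (fun _ => (0 : E)) σ := by
      funext j k y
      simp only [driftTensor_apply, Pi.zero_apply, hu_in σ hσ']
    simp only [e1, e2]
  -- the restarted identity: `u + D = e^{τΔ}V(s₀)` on the window
  have hrep : ∀ τ ∈ Ioo 0 T', ∀ x,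
      u τ x + driftDuhamel u (fun _ => (0 : E)) 0 τ x = UnboundedOperators.heatExtension (V s₀) τ x := by
    intro τ hτ x
    rw [hu_in τ hτ, ← hD τ hτ x, h.mild s₀ (τ + s₀) hs₀.1 (by linarith [hτ.1]) (hwin τ hτ).2 x]
    simp
  -- the weak identity for `u` on the slab `(0, T')`
  have hident : ∀ ψ : ℝ → E → E, IsSpaceTimeTestOn (slab E (Ioo 0 T') isOpen_Ioo) ψ →
      (∀ t, VectorCalculus.IsDivFree (ψ t)) →
      ∫ t in Ioo 0 T', ∫ x, (⟪u t x, timeDeriv ψ t x⟫ + ⟪u t x, convect (u t) (ψ t) x⟫ +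
        1 * ⟪u t x, Δ (ψ t) x⟫) = 0 := by
    intro ψ hψ hψd
    have hψ' : IsSpaceTimeTestOn (⊤ : Opens (ℝ × E)) ψ := hψ.mono le_top
    set Λ : ℝ → E → E := fun t x => timeDeriv ψ t x + (1 : ℝ) • Δ (ψ t) x with hΛ_def
    have hΛ : IsSpaceTimeTestOn (⊤ : Opens (ℝ × E)) Λ := hψ'.heatAdjointField_top 1
    have hΛeq : ∀ t x, timeDeriv ψ t x + Δ (ψ t) x = Λ t x := fun t x => by simp [hΛ_def]
    set D : ℝ → E → E := fun t x => driftDuhamel u (fun _ => (0 : E)) 0 t x with hD_def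
    -- the two identities
    have hW := integral_inner_driftDuhamel_zero_heatAdjoint_eq hE hum huM hT' hψ hψd
    have hC := integral_integral_inner_heatExtension_heatAdjoint_eq_zero
      ((h.measurable.comp (measurable_const.prodMk measurable_id)).aestronglyMeasurable)
      (fun x => h.norm_le s₀ hs₀ x) hT' hψ
    simp_rw [hΛeq] at hW hC ⊢
    -- integrability on the slab
    have hslm : ∀ τ, AEStronglyMeasurable (u τ) volume := fun τ =>
      (hum.comp (measurable_const.prodMk measurable_id)).aestronglyMeasurable
    have hmeas' : AEStronglyMeasurable (uncurry u) ((volume.restrict (Ioc 0 T')).prod (volume : Measure E)) :=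
      hum.aestronglyMeasurable
    have hmono : volume.restrict (Ioo (0:ℝ) T') ≤ volume.restrict (Ioc 0 T') :=
      Measure.restrict_mono Ioo_subset_Ioc_self le_rfl
    have hP : Integrable (fun t => ∫ x, ⟪u t x, Λ t x⟫) (volume.restrict (Ioo 0 T')) :=
      ((integrable_prod_inner_test_of_norm_le hmeas' (fun t _ => hslm t) (fun t _ x => huM t x)
        hΛ).integral_prod_left).mono_measure hmono
    have hQ : Integrable (fun t => ∫ x, ⟪u t x, fderiv ℝ (ψ t) x (u t x)⟫) (volume.restrict (Ioo 0 T')) :=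
      ((integrable_prod_inner_convect_test_of_norm_le hmeas' (fun t _ => hslm t) (fun t _ x => huM t x)
        hψ').integral_prod_left).mono_measure hmono
    have hDm : AEStronglyMeasurable (uncurry D) ((volume.restrict (Ioc 0 T')).prod (volume : Measure E)) :=
      aestronglyMeasurable_uncurry_driftDuhamel_zero hE hum huM le_rfl
    have hDsl : ∀ t ∈ Ioc (0:ℝ) T', AEStronglyMeasurable (D t) volume := fun t ht =>
      (continuous_integral_sum_oseenHeat_duhamel hE (FluidPDE.measurable_driftTensor hum measurable_const)
        (by positivity) ht.1.le (fun σ _ => abs_driftTensor_zero_le huM σ)).aestronglyMeasurable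
    have hDM : ∀ t ∈ Ioc (0:ℝ) T', ∀ x, ‖D t x‖ ≤ 70632 * N ^ 2 * T' ^ (1 / 2 : ℝ) := fun t ht x =>
      norm_driftDuhamel_zero_le hE hum huM (Ioc_subset_Icc_self ht) x
    have hR : Integrable (fun t => ∫ x, ⟪D t x, Λ t x⟫) (volume.restrict (Ioo 0 T')) :=
      ((integrable_prod_inner_test_of_norm_le hDm hDsl hDM hΛ).integral_prod_left).mono_measure hmono
    have hLint : ∀ t, Integrable (Λ t) volume := fun t =>
      (hΛ.contDiff_slice t).continuous.integrable_of_hasCompactSupport (hΛ.hasCompactSupport_slice t)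
    -- slice identities
    have e1 : ∀ t ∈ Ioo (0:ℝ) T', ∫ x, ⟪UnboundedOperators.heatExtension (V s₀) t x, Λ t x⟫ =
        (∫ x, ⟪u t x, Λ t x⟫) + ∫ x, ⟪D t x, Λ t x⟫ := by
      intro t ht
      have i1 : Integrable (fun x => ⟪u t x, Λ t x⟫) volume :=
        integrable_inner_of_aestronglyMeasurable_of_norm_le (hslm t) (fun x => huM t x) (hLint t)
      have i2 : Integrable (fun x => ⟪D t x, Λ t x⟫) volume :=
        integrable_inner_of_aestronglyMeasurable_of_norm_le (hDsl t ⟨ht.1, ht.2.le⟩)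
          (fun x => hDM t ⟨ht.1, ht.2.le⟩ x) (hLint t)
      rw [← integral_add i1 i2]
      refine integral_congr_ae (Eventually.of_forall fun x => ?_)
      show ⟪UnboundedOperators.heatExtension (V s₀) t x, Λ t x⟫ = ⟪u t x, Λ t x⟫ + ⟪D t x, Λ t x⟫
      rw [← inner_add_left, hrep t ht x]
    have e2 : ∀ t ∈ Ioo (0:ℝ) T',
        (∫ x, (⟪u t x, timeDeriv ψ t x⟫ + ⟪u t x, convect (u t) (ψ t) x⟫ + 1 * ⟪u t x, Δ (ψ t) x⟫)) =
          (∫ x, ⟪u t x, Λ t x⟫) + ∫ x, ⟪u t x, fderiv ℝ (ψ t) x (u t x)⟫ := by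
      intro t ht
      have iP : Integrable (fun x => ⟪u t x, Λ t x⟫) volume :=
        integrable_inner_of_aestronglyMeasurable_of_norm_le (hslm t) (fun x => huM t x) (hLint t)
      have iQ : Integrable (fun x => ⟪u t x, fderiv ℝ (ψ t) x (u t x)⟫) volume :=
        (integrable_inner_clm_apply_of_norm_le (hslm t) (fun x => huM t x)
          ((hψ'.fderiv_top.contDiff_slice t).continuous.integrable_of_hasCompactSupport
            (hψ'.fderiv_top.hasCompactSupport_slice t))).1
      rw [← integral_add iP iQ]
      refine integral_congr_ae (Eventually.of_forall fun x => ?_)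
      simp only [hΛ_def, inner_add_right, real_inner_smul_right, convect_apply]
      ring
    -- `∫∫⟨e^{tΔ}V(s₀), Λ⟩ = ∫∫⟨u, Λ⟩ + ∫∫⟨D, Λ⟩ = 0`
    have hsum : (∫ t in Ioo 0 T', ∫ x, ⟪u t x, Λ t x⟫) + ∫ t in Ioo 0 T', ∫ x, ⟪D t x, Λ t x⟫ = 0 := by
      rw [← integral_add hP hR, ← setIntegral_congr_fun measurableSet_Ioo e1]
      exact hC
    have hW' : ∫ t in Ioo 0 T', ∫ x, ⟪D t x, Λ t x⟫ =
        ∫ t in Ioo 0 T', ∫ x, ⟪u t x, fderiv ℝ (ψ t) x (u t x)⟫ := by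
      rw [hD_def]
      simpa only [convect_apply] using hW
    rw [setIntegral_congr_fun measurableSet_Ioo e2, integral_add hP hQ, ← hW']
    exact hsum
  -- a.e. weak divergence-freeness transfers along the time shift
  have hdivu : ∀ᵐ τ ∂((volume : Measure ℝ).restrict (Ioo 0 T')), IsWeaklyDivFree (u τ) := by
    have h1 := h.ae_isWeaklyDivFree
    rw [ae_restrict_iff' measurableSet_Ioo] at h1 ⊢
    have h2 := (measurePreserving_add_right (volume : Measure ℝ) s₀).quasiMeasurePreserving.ae h1
    filter_upwards [h2] with τ hτ hτI
    rw [hu_in τ hτI]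
    exact hτ (hwin τ hτI)
  -- the class for `u` on `(0, T')`
  have hu : IsBoundedWeakNSSolutionOn (Ioo 0 T') isOpen_Ioo 1 u :=
    ⟨hum.aestronglyMeasurable, ⟨N, fun t _ x => huM t x⟩, hdivu, hident⟩
  -- back to `V` on `(s₀, T)`
  have hshift := hu.comp_add_right (-s₀) (J := Ioo s₀ T) isOpen_Ioo (fun t => by
    simp only [mem_Ioo, hT'def]; constructor <;> intro ht <;> constructor <;> linarith [ht.1, ht.2])
  refine hshift.congr_slices fun t ht => ?_
  have ht' : t + -s₀ ∈ Ioo 0 T' := ⟨by linarith [ht.1], by rw [hT'def]; linarith [ht.2]⟩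
  simp only [hu_in _ ht', neg_add_cancel_right]

end IsKNSSDriftMild

end MildWeak

/-! ### The vorticity equation (4.8) for smooth restarted-mild fields, integrated in time -/

section Vorticity48

/-- **KNSS 2009, (4.8) for smooth restarted-mild fields: the vorticity equation in time-integrated
form.** If `V` is restarted-mild on `(0, T)` (`IsKNSSDriftMild T N V 0`) and jointly smooth on
`(0, T) × ℝ³`, then for all `x` and `0 < s ≤ t < T`, with `ω = curl V`,
`ω(t, x) − ω(s, x) = ∫ₛᵗ (Δω − Dω[V] + DV[ω])(τ, x) dτ`. Proof: on the window `(s/2, T)` the field is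
a bounded weak solution (`isBoundedWeakNSSolutionOn_of_mem_Ioo`); after the time shift
`W(τ) = V(τ + s/2)`, smoothness gives the projected momentum equation
(`integral_inner_momentum_eq_zero_of_slab_weak`), a pressure
(`exists_isClassicalNSSolutionOn_of_forall_integral_inner_eq_zero`) and the classical vorticity
equation (`IsClassicalNSSolutionOn.vorticity_eq`), which is integrated in `τ`.
[cite: KochNadirashviliSereginSverak2009, §4 (4.8) (arXiv:0709.3599v1 p. 8)] -/
theorem IsKNSSDriftMild.curl_sub_curl_eq_integral {T N : ℝ}
    {V : ℝ → EuclideanSpace ℝ (Fin 3) → EuclideanSpace ℝ (Fin 3)} (h : IsKNSSDriftMild T N V 0)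
    (hsm : IsSmoothSpaceTimeOn (Ioo 0 T) V) (x : EuclideanSpace ℝ (Fin 3)) {s t : ℝ} (hs : 0 < s)
    (hst : s ≤ t) (htT : t < T) :
    curl (V t) x - curl (V s) x =
      ∫ τ in s..t, ((Δ (curl (V τ))) x - fderiv ℝ (curl (V τ)) x (V τ x) +
        fderiv ℝ (V τ) x (curl (V τ) x)) := by
  have hE : Module.finrank ℝ (EuclideanSpace ℝ (Fin 3)) = 3 := by simp
  set s₀ : ℝ := s / 2 with hs₀
  have hs₀T : s₀ ∈ Ioo 0 T := ⟨by rw [hs₀]; linarith, by rw [hs₀]; linarith⟩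
  set T' : ℝ := T - s₀ with hT'
  set W : ℝ → EuclideanSpace ℝ (Fin 3) → EuclideanSpace ℝ (Fin 3) := fun τ => V (τ + s₀) with hWdef
  have hSU : UniqueDiffOn ℝ (Ioo 0 T') := isOpen_Ioo.uniqueDiffOn
  -- weak on `(0, T')`
  have hVweak := h.isBoundedWeakNSSolutionOn_of_mem_Ioo hE hs₀T
  have hWweak : IsBoundedWeakNSSolutionOn (Ioo 0 T') isOpen_Ioo 1 W :=
    hVweak.comp_add_right s₀ (J := Ioo 0 T') isOpen_Ioo fun τ => by
      simp only [mem_Ioo, hT']; constructor <;> intro hτ <;> constructor <;> linarith [hτ.1, hτ.2]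
  -- smooth on `(0, T')`
  have hWsm : IsSmoothSpaceTimeOn (Ioo 0 T') W := by
    have h1 := hsm.comp_add_right s₀
    refine ContDiffOn.mono h1 (prod_mono (fun τ hτ => ?_) Subset.rfl)
    simp only [mem_preimage, mem_Ioo] at hτ ⊢
    constructor <;> [linarith [hτ.1, hs₀T.1]; (rw [hT'] at hτ; linarith [hτ.2])]
  -- divergence free at every time
  have hWdiv : ∀ τ ∈ Ioo 0 T', VectorCalculus.IsDivFree (W τ) := by
    intro τ hτ
    have hτ' : τ + s₀ ∈ Ioo 0 T := ⟨by linarith [hτ.1, hs₀T.1], by rw [hT'] at hτ; linarith [hτ.2]⟩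
    exact isDivFree_of_ae_isWeaklyDivFree_of_smooth hsm h.ae_isWeaklyDivFree hτ'
  -- the projected momentum equation and the pressure
  have horth : ∀ τ ∈ Ioo 0 T', ∀ φ : EuclideanSpace ℝ (Fin 3) → EuclideanSpace ℝ (Fin 3),
      FunctionSpaces.IsTestFunctionOn (⊤ : Opens (EuclideanSpace ℝ (Fin 3))) φ →
      VectorCalculus.IsDivFree φ →
        ∫ y, ⟪timeDerivWithin (Ioo 0 T') W τ y + convect (W τ) (W τ) y - (1 : ℝ) • (Δ (W τ)) y -
          (0 : ℝ → EuclideanSpace ℝ (Fin 3) → EuclideanSpace ℝ (Fin 3)) τ y, φ y⟫ = 0 :=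
    fun τ hτ φ hφ hφd =>
      integral_inner_momentum_eq_zero_of_slab_weak hWsm hWdiv hWweak.2.2.2 hτ hφ hφd
  have hf0 : IsSmoothSpaceTimeOn (Ioo 0 T')
      (0 : ℝ → EuclideanSpace ℝ (Fin 3) → EuclideanSpace ℝ (Fin 3)) := contDiffOn_const
  obtain ⟨p, hcl⟩ := exists_isClassicalNSSolutionOn_of_forall_integral_inner_eq_zero isOpen_Ioo
    hWsm hf0 hWdiv horth
  -- the classical vorticity equation
  have hcl' : Ioo 0 T' ⊆ closure (interior (Ioo 0 T')) := by
    rw [interior_Ioo]; exact subset_closure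
  have hvort := fun {τ : ℝ} (hτ : τ ∈ Ioo 0 T') (y : EuclideanSpace ℝ (Fin 3)) =>
    hcl.vorticity_eq hSU hcl' (fun _ _ z => curl_zero z) hτ y
  -- smoothness of the vorticity and the FTC in time
  have hωsm : IsSmoothSpaceTimeOn (Ioo 0 T') (vorticity W) := by
    have e : vorticity W = fun τ y => curlCLM (fderiv ℝ (W τ) y) := by
      funext τ y; rw [vorticity_apply, curl_eq_curlCLM]
    rw [e]
    exact curlCLM.contDiff.comp_contDiffOn (hWsm.fderiv_slice hSU)
  set σ₁ : ℝ := s - s₀ with hσ₁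
  set σ₂ : ℝ := t - s₀ with hσ₂
  have hσ₁0 : 0 < σ₁ := by rw [hσ₁, hs₀]; linarith
  have hσ₁₂ : σ₁ ≤ σ₂ := by rw [hσ₁, hσ₂]; linarith
  have hσ₂T : σ₂ < T' := by rw [hσ₂, hT']; linarith
  have hIcc : Icc σ₁ σ₂ ⊆ Ioo 0 T' := fun τ hτ => ⟨hσ₁0.trans_le hτ.1, hτ.2.trans_lt hσ₂T⟩
  have hderiv : ∀ τ ∈ uIcc σ₁ σ₂, HasDerivAt (fun τ' => vorticity W τ' x)
      (timeDerivWithin (Ioo 0 T') (vorticity W) τ x) τ := by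
    intro τ hτ
    rw [uIcc_of_le hσ₁₂] at hτ
    have hτ' := hIcc hτ
    exact (hωsm.hasDerivWithinAt_timeDerivWithin hSU hτ' x).hasDerivAt (Ioo_mem_nhds hτ'.1 hτ'.2)
  have hint : IntervalIntegrable (fun τ => timeDerivWithin (Ioo 0 T') (vorticity W) τ x) volume σ₁ σ₂ := by
    refine ContinuousOn.intervalIntegrable ?_
    rw [uIcc_of_le hσ₁₂]
    have hc := hωsm.continuousOn_timeDerivWithin hSU
    exact ContinuousOn.comp (f := fun τ : ℝ => ((τ, x) : ℝ × EuclideanSpace ℝ (Fin 3)))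
      (g := fun z : ℝ × EuclideanSpace ℝ (Fin 3) => timeDerivWithin (Ioo 0 T') (vorticity W) z.1 z.2)
      hc (continuous_id.prodMk continuous_const).continuousOn
      (fun τ hτ => mk_mem_prod (hIcc hτ) (mem_univ x))
  have hftc := intervalIntegral.integral_eq_sub_of_hasDerivAt hderiv hint
  -- identify the two sides
  have eW : ∀ τ, W τ = V (τ + s₀) := fun τ => rfl
  have et : σ₂ + s₀ = t := by rw [hσ₂]; ring
  have es : σ₁ + s₀ = s := by rw [hσ₁]; ring
  have lhs : vorticity W σ₂ x - vorticity W σ₁ x = curl (V t) x - curl (V s) x := by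
    rw [vorticity_apply, vorticity_apply, eW, eW, et, es]
  rw [← lhs, ← hftc]
  -- the integrand
  have hinteg : ∀ τ ∈ Icc σ₁ σ₂, timeDerivWithin (Ioo 0 T') (vorticity W) τ x =
      (Δ (curl (V (τ + s₀)))) x - fderiv ℝ (curl (V (τ + s₀))) x (V (τ + s₀) x) +
        fderiv ℝ (V (τ + s₀)) x (curl (V (τ + s₀)) x) := by
    intro τ hτ
    have hv := hvort (hIcc hτ) x
    rw [vorticity_apply, convect_apply, convect_apply, one_smul] at hv
    rw [eq_sub_of_add_eq hv, eW]
    abel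
  rw [intervalIntegral.integral_congr (fun τ hτ => hinteg τ (by rwa [uIcc_of_le hσ₁₂] at hτ))]
  -- shift the time variable back
  have hcv := intervalIntegral.integral_comp_add_right (a := σ₁) (b := σ₂)
    (fun τ => (Δ (curl (V τ))) x - fderiv ℝ (curl (V τ)) x (V τ x) + fderiv ℝ (V τ) x (curl (V τ) x)) s₀
  rw [et, es] at hcv
  exact hcv

/-- **Discharge of the named fact `KNSS2009_vorticity48_mild`** ((4.8) in integrated form for
smooth restarted-mild fields). [cite: KochNadirashviliSereginSverak2009, §4 (4.8) (arXiv:0709.3599v1 p. 8)] -/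
theorem KNSS2009_vorticity48_mild_holds : KNSS2009_vorticity48_mild :=
  fun _ _ _ h hsm x _ _ hs hst htT => h.curl_sub_curl_eq_integral hsm x hs hst htT

/-- **KNSS's §4 regularity of bounded mild solutions from Proposition 4.1 alone**
(`KNSS2009_mild_regularity_of_prop41` with the vorticity input discharged). [cite: KochNadirashviliSereginSverak2009, §4 (4.8)–(4.11) with Prop. 4.1 (arXiv:0709.3599v1 p. 8)] -/
theorem KNSS2009_mild_regularity_of_prop41' (h41 : KNSS2009_prop41_mild) : KNSS2009_mild_regularity :=
  KNSS2009_mild_regularity_of_prop41 h41 KNSS2009_vorticity48_mild_holds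

/-- **The window regularity fact from Lemma 3.1 and Proposition 4.1** (Galilean covariance and
(4.8) discharged in the tree). [cite: KochNadirashviliSereginSverak2009, §4 closing paragraph with Lemma 3.1 and Prop. 4.1 (arXiv:0709.3599v1 pp. 7–8)] -/
theorem KNSS2009_regularity_boundedWeak_window_of_prop41' (h31 : KNSS2009_weak_driftMild)
    (h41 : KNSS2009_prop41_mild) : KNSS2009_regularity_boundedWeak_window :=
  KNSS2009_regularity_boundedWeak_window_of_prop41 h31 IsKNSSDriftMild.galileanCovariance_R3 h41
    KNSS2009_vorticity48_mild_holds

/-- **The ancient regularity fact** `KNSS2009_regularity_boundedWeak_ancient` — the input "by the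
results of Section 4, `|∇ᵏₓu| ≤ C_k` in `ℝ³ × (−∞, 0)`" of the proofs of KNSS's Theorems 5.2–5.3 —
**from Lemma 3.1 (`KNSS2009_weak_driftMild`) and Proposition 4.1 (`KNSS2009_prop41_mild`) only**:
the ancient gluing, the drift-mild decomposition glue, the Galilean covariance of the drift-mild
class, the constants glue and the vorticity equation are all proved in the tree. [cite: KochNadirashviliSereginSverak2009, §5 proof of Thm 5.2, first sentence (arXiv:0709.3599v1 p. 10), with §4 and Lemma 3.1] -/
theorem KNSS2009_regularity_boundedWeak_ancient_of_prop41' (h31 : KNSS2009_weak_driftMild)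
    (h41 : KNSS2009_prop41_mild) : KNSS2009_regularity_boundedWeak_ancient :=
  KNSS2009_regularity_boundedWeak_ancient_of_prop41 h31 IsKNSSDriftMild.galileanCovariance_R3 h41
    KNSS2009_vorticity48_mild_holds

end Vorticity48

end Literature.Analysis.FluidPDE

end
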